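import Summits.KontsevichZagierPeriods.KontsevichZagierPeriods.Theorems.RootDecompQuadraticDescentEisensteinPairP6

/-!
# Census pair #22 (the ℚ(√−3) pair 4·[□²,1/(3−2N)] ≡ 5·[□²,1/(3−N)], N = u²−uv+v²) and #0 DECIDED in `KZ.relations` by rules 1+2 (route `RootDecompQuadraticDescent`, instances of crux stmt-KontsevichZagierPeriods-28994 / stmt-4280) · part 7/9

Cell `decomp-kz`, lens 6 (decomp-kz-lens-6 g7): `pair22` (NO Stokes; blow-up + conic log band + seven ℚ-rational base substitutions; every piecewise-affine chain certified impossible) and `pair0`; packaged `pairs_decided`, `pairs_descentTwoQ_instances`, `pairs_of_kzDimTwo` BY NAME.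

Source: `HOME/decomp-kz-lens-6/g7/EisensteinPair22.lean` sha256 fdb5e0bbc5a4a341 (1894 l; critic decomp-kz-crit-1 g2 CLEARED 2026-08-30T07:59:44Z, std axioms), split by the landing seat decomp-kz-census-1 g7 (earlier parts as landed; the remainder re-cut smaller to respect the 400-line policy after private dedup copies); the route file is imported only by the last part.  No `sorry`; standard axioms.  References: [cite: KontsevichZagier2001, §1.2].
-/

noncomputable section

open MeasureTheory Set MvPolynomial

namespace Summit.KontsevichZagierPeriods.RootDecompQuadraticDescent.EisensteinPair

open Literature.NumberTheory.Transcendental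
open Literature.NumberTheory.Transcendental.KZ
open Literature.ModelTheory.ExponentialFields (IsSemialgebraic)

-- PRIVATE copy (the lemma is private in an earlier landed part):
/-- `w = snoc (init w) 0 + w_last • (0,…,0,1)`: the splitting of `ℝᵐ⁺¹ = ℝᵐ × ℝ` used in the Jacobian
computation of `KZ.of_sub_of_mem_relations_of_fibreMap`. (Source: cell `decomp-kz`, lens 2 gen 4,
`RationalCubeDichotomy.lean` v5, sha256 `eccce7f4…`, l. 1699.) [folklore] -/
private theorem eq_snoc_init_zero_add' (m : ℕ) (w : Fin (m + 1) → ℝ) :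
    w = Fin.snoc (Fin.init w) (0 : ℝ) + w (Fin.last m) • (Pi.single (Fin.last m) (1 : ℝ) : Fin (m + 1) → ℝ) := by
  ext i
  refine Fin.lastCases ?_ (fun j => ?_) i
  · simp
  · simp [(Fin.castSucc_lt_last j).ne, Fin.init]

-- PRIVATE copy (landed twin elsewhere; dedup.landed): snoc2_zero, snoc2_one, init2_zero, last_one_eq, of_sub_of_mem_relations_of_fibreMap'
/-- `snoc2_zero`: auxiliary theorem of the lens-6 development «eis» (instances of 28994/4280) — see the module docstring; verbatim from the lens file. -/
@[simp] private theorem snoc2_zero (x : Fin 1 → ℝ) (t : ℝ) : (Fin.snoc x t : Fin 2 → ℝ) 0 = x 0 := rfl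

/-- `snoc2_one`: auxiliary theorem of the lens-6 development «eis» (instances of 28994/4280) — see the module docstring; verbatim from the lens file. -/
@[simp] private theorem snoc2_one (x : Fin 1 → ℝ) (t : ℝ) : (Fin.snoc x t : Fin 2 → ℝ) 1 = t := rfl

/-- `init2_zero`: auxiliary theorem of the lens-6 development «eis» (instances of 28994/4280) — see the module docstring; verbatim from the lens file. -/
@[simp] private theorem init2_zero (z : Fin 2 → ℝ) : Fin.init z 0 = z 0 := rfl

/-- `last_one_eq`: auxiliary theorem of the lens-6 development «eis» (instances of 28994/4280) — see the module docstring; verbatim from the lens file. -/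
private theorem last_one_eq : (Fin.last 1 : Fin 2) = 1 := rfl

/-- **Fibred substitution with a Jacobian allowed to vanish on the lower edge.** Verbatim copy of
`KZ.of_sub_of_mem_relations_of_fibreMap` (Literature/NumberTheory/Transcendental/KZFibreMapMove.lean)
with the hypothesis `0 < ψs` weakened to the OPEN fibres `a y < s < b y` plus `0 ≤ ψs` on the closed
band — exactly what strict monotonicity (`strictMonoOn_of_deriv_pos` on the interior) and the
integrand identity (`|det| = ψs`) use. Needed here because the substitution `s ↦ 3/(3 − μs²q(u))`
has `∂/∂s = 0` on the edge `s = 0` (the exceptional divisor of the blow-up).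
[cite: KontsevichZagier2001, §1.2 rule 2] -/
private theorem of_sub_of_mem_relations_of_fibreMap' {m : ℕ} {G : Set (Fin m → ℝ)}
    {a b a' b' : (Fin m → ℝ) → ℝ} (ψ ψs : (Fin (m + 1) → ℝ) → ℝ)
    (r r' : IntegralRep (m + 1)) (hr : r.domain = KZlog.band G a b)
    (hr' : r'.domain = KZlog.band G a' b') (hab : ∀ y ∈ G, a y ≤ b y)
    (hψ : IsSemialgebraicFunOn ℚ r.domain ψ)
    (hψd : ∀ z ∈ r.domain, DifferentiableAt ℝ ψ z)
    (hψs : ∀ z ∈ r.domain,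
      HasDerivAt (fun t : ℝ => ψ (Fin.snoc (Fin.init z) t)) (ψs z) (z (Fin.last m)))
    (hpos : ∀ z ∈ r.domain, a (Fin.init z) < z (Fin.last m) → z (Fin.last m) < b (Fin.init z) → 0 < ψs z)
    (hnn : ∀ z ∈ r.domain, 0 ≤ ψs z)
    (ha : ∀ y ∈ G, ψ (Fin.snoc y (a y)) = a' y) (hb : ∀ y ∈ G, ψ (Fin.snoc y (b y)) = b' y)
    (hint : ∀ z ∈ r.domain, r.integrand z = r'.integrand (Fin.snoc (Fin.init z) (ψ z)) * ψs z) :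
    of r - of r' ∈ relations := by
  have hmemG : ∀ z ∈ r.domain, Fin.init z ∈ G := fun z hz => by
    rw [hr] at hz
    exact hz.1
  have hsnoc_mem : ∀ y ∈ G, ∀ t ∈ Icc (a y) (b y), (Fin.snoc y t : Fin (m + 1) → ℝ) ∈ r.domain := by
    intro y hy t ht
    rw [hr, KZlog.snoc_mem_band]
    exact ⟨hy, ht⟩
  -- the fibre maps
  have hfib_deriv : ∀ y ∈ G, ∀ t ∈ Icc (a y) (b y),
      HasDerivAt (fun s : ℝ => ψ (Fin.snoc y s)) (ψs (Fin.snoc y t)) t := by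
    intro y hy t ht
    have h := hψs _ (hsnoc_mem y hy t ht)
    simpa only [Fin.init_snoc, Fin.snoc_last] using h
  have hfib_cont : ∀ y ∈ G, ContinuousOn (fun s : ℝ => ψ (Fin.snoc y s)) (Icc (a y) (b y)) :=
    fun y hy t ht => (hfib_deriv y hy t ht).continuousAt.continuousWithinAt
  have hfib_mono : ∀ y ∈ G, StrictMonoOn (fun s : ℝ => ψ (Fin.snoc y s)) (Icc (a y) (b y)) := by
    intro y hy
    refine strictMonoOn_of_deriv_pos (convex_Icc _ _) (hfib_cont y hy) fun t ht => ?_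
    rw [interior_Icc] at ht
    have hd := hfib_deriv y hy t (Ioo_subset_Icc_self ht)
    rw [hd.deriv]
    exact hpos _ (hsnoc_mem y hy t (Ioo_subset_Icc_self ht)) (by simpa using ht.1) (by simpa using ht.2)
  -- the substitution
  set Φ : (Fin (m + 1) → ℝ) → (Fin (m + 1) → ℝ) := fun z => Fin.snoc (Fin.init z) (ψ z) with hΦ
  let Φ' : (Fin (m + 1) → ℝ) → (Fin (m + 1) → ℝ) →L[ℝ] (Fin (m + 1) → ℝ) := fun z =>
    ContinuousLinearMap.pi
      (Fin.lastCases (motive := fun _ => (Fin (m + 1) → ℝ) →L[ℝ] ℝ) (fderiv ℝ ψ z)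
        (fun i => ContinuousLinearMap.proj (Fin.castSucc i)))
  have hΦ' : ∀ z w, Φ' z w = Fin.snoc (Fin.init w) (fderiv ℝ ψ z w) := by
    intro z w
    funext i
    refine Fin.lastCases ?_ (fun j => ?_) i
    · simp [Φ']
    · simp [Φ', Fin.init]
  -- the partial derivative along the last coordinate is `ψs`
  have hlast : ∀ z ∈ r.domain, fderiv ℝ ψ z (Pi.single (Fin.last m) 1) = ψs z := by
    intro z hz
    have hγ : HasDerivAt (fun t : ℝ => (Fin.snoc (Fin.init z) t : Fin (m + 1) → ℝ))
        (Pi.single (Fin.last m) (1 : ℝ)) (z (Fin.last m)) := by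
      rw [hasDerivAt_pi]
      intro i
      refine Fin.lastCases ?_ (fun j => ?_) i
      · simpa using hasDerivAt_id' (z (Fin.last m))
      · simpa [(Fin.castSucc_lt_last j).ne, Fin.init] using hasDerivAt_const (z (Fin.last m)) (z (Fin.castSucc j))
    have h1 : HasDerivAt (fun t : ℝ => ψ (Fin.snoc (Fin.init z) t))
        (fderiv ℝ ψ z (Pi.single (Fin.last m) 1)) (z (Fin.last m)) := by
      have hψz : HasFDerivAt ψ (fderiv ℝ ψ z) (Fin.snoc (Fin.init z) (z (Fin.last m))) := by
        rw [Fin.snoc_init_self]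
        exact (hψd z hz).hasFDerivAt
      exact hψz.comp_hasDerivAt (z (Fin.last m)) hγ
    exact h1.unique (hψs z hz)
  -- determinant
  have hdet : ∀ z ∈ r.domain, (Φ' z).det = ψs z := by
    intro z hz
    let E : (Fin m → ℝ) →ₗ[ℝ] (Fin (m + 1) → ℝ) :=
      LinearMap.pi (Fin.lastCases (motive := fun _ => (Fin m → ℝ) →ₗ[ℝ] ℝ) 0
        (fun i => LinearMap.proj i))
    have hE : ∀ y, E y = Fin.snoc y 0 := by
      intro y
      funext i
      refine Fin.lastCases ?_ (fun j => ?_) i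
      · simp [E]
      · simp [E]
    have h := LinearMap.det_of_snoc_init (Φ' z : (Fin (m + 1) → ℝ) →ₗ[ℝ] (Fin (m + 1) → ℝ))
      LinearMap.id ((fderiv ℝ ψ z : (Fin (m + 1) → ℝ) →ₗ[ℝ] ℝ).comp E)
      (fderiv ℝ ψ z (Pi.single (Fin.last m) 1)) (fun w => by
        rw [ContinuousLinearMap.coe_coe, hΦ', LinearMap.id_apply, LinearMap.comp_apply,
          ContinuousLinearMap.coe_coe, hE]
        congr 1
        conv_lhs => rw [eq_snoc_init_zero_add' m w]
        rw [map_add, map_smul, smul_eq_mul, mul_comm])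
    rw [LinearMap.det_id, mul_one, hlast z hz] at h
    exact h
  -- derivative
  have hderiv : ∀ z ∈ r.domain, HasFDerivAt Φ (Φ' z) z := by
    intro z hz
    rw [hasFDerivAt_pi']
    intro i
    refine Fin.lastCases ?_ (fun j => ?_) i
    · have hfun : (fun x => Φ x (Fin.last m)) = ψ := by
        funext x
        simp [hΦ]
      show HasFDerivAt (fun x => Φ x (Fin.last m)) _ z
      rw [hfun]
      refine (hψd z hz).hasFDerivAt.congr_fderiv (ContinuousLinearMap.ext fun w => ?_)
      simp [hΦ']
    · have hfun : (fun x => Φ x (Fin.castSucc j)) = fun x => x (Fin.castSucc j) := by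
        funext x
        simp [hΦ, Fin.init]
      show HasFDerivAt (fun x => Φ x (Fin.castSucc j)) _ z
      rw [hfun]
      refine (hasFDerivAt_apply (Fin.castSucc j) z).congr_fderiv
        (ContinuousLinearMap.ext fun w => ?_)
      simp [hΦ', Fin.init]
  refine changeOfVariablesRel_subset_relations ⟨m + 1, r, r', Φ, Φ', ?_, ?_, ?_, ?_, ?_, rfl⟩
  · -- semialgebraic map
    refine (isSemialgebraicMapOn_iff_forall_holds r.isSemialgebraic_domain).mpr fun i => ?_
    refine Fin.lastCases ?_ (fun j => ?_) i
    · exact hψ.congr fun z _ => by simp [hΦ]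
    · exact (isSemialgebraicFunOn_aeval r.isSemialgebraic_domain
        (MvPolynomial.X (Fin.castSucc j))).congr fun z _ => by simp [hΦ, Fin.init]
  · exact fun z hz => (hderiv z hz).hasFDerivWithinAt
  · -- injective
    intro z₁ hz₁ z₂ hz₂ h
    have hy : Fin.init z₁ = Fin.init z₂ := by
      have := congrArg Fin.init h
      simpa [hΦ] using this
    have hl : ψ z₁ = ψ z₂ := by
      have := congrFun h (Fin.last m)
      simpa [hΦ] using this
    have hyG : Fin.init z₂ ∈ G := hmemG z₂ hz₂
    have ht₁ : z₁ (Fin.last m) ∈ Icc (a (Fin.init z₂)) (b (Fin.init z₂)) := by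
      rw [hr] at hz₁; rw [← hy]; exact hz₁.2
    have ht₂ : z₂ (Fin.last m) ∈ Icc (a (Fin.init z₂)) (b (Fin.init z₂)) := by
      rw [hr] at hz₂; exact hz₂.2
    have hl' : ψ (Fin.snoc (Fin.init z₂) (z₁ (Fin.last m))) = ψ (Fin.snoc (Fin.init z₂) (z₂ (Fin.last m))) := by
      rw [Fin.snoc_init_self]
      conv_lhs => rw [← hy, Fin.snoc_init_self]
      exact hl
    have hs : z₁ (Fin.last m) = z₂ (Fin.last m) := (hfib_mono _ hyG).injOn ht₁ ht₂ hl'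
    rw [← Fin.snoc_init_self z₁, ← Fin.snoc_init_self z₂, hy, hs]
  · -- image
    rw [hr']
    ext w
    simp only [mem_image]
    constructor
    · intro hw
      rw [KZlog.mem_band] at hw
      obtain ⟨hy, hw1, hw2⟩ := hw
      have hab' := hab _ hy
      have hivt := intermediate_value_Icc hab' (hfib_cont _ hy)
      rw [ha _ hy, hb _ hy] at hivt
      obtain ⟨t, ht, hwt⟩ := hivt ⟨hw1, hw2⟩
      have hwt' : ψ (Fin.snoc (Fin.init w) t) = w (Fin.last m) := hwt
      refine ⟨Fin.snoc (Fin.init w) t, hsnoc_mem _ hy t ht, ?_⟩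
      simp only [hΦ, Fin.init_snoc]
      rw [hwt', Fin.snoc_init_self]
    · rintro ⟨z, hz, rfl⟩
      have hy : Fin.init z ∈ G := hmemG z hz
      have ht : z (Fin.last m) ∈ Icc (a (Fin.init z)) (b (Fin.init z)) := by
        rw [hr] at hz; exact hz.2
      have hmono := (hfib_mono _ hy).monotoneOn
      have haz : a (Fin.init z) ∈ Icc (a (Fin.init z)) (b (Fin.init z)) := left_mem_Icc.mpr (hab _ hy)
      have hbz : b (Fin.init z) ∈ Icc (a (Fin.init z)) (b (Fin.init z)) := right_mem_Icc.mpr (hab _ hy)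
      have h1 := hmono haz ht ht.1
      have h2 := hmono ht hbz ht.2
      simp only [ha _ hy, hb _ hy, Fin.snoc_init_self] at h1 h2
      rw [KZlog.mem_band]
      simp only [hΦ, Fin.init_snoc, Fin.snoc_last]
      exact ⟨hy, h1, h2⟩
  · intro z hz
    rw [hint z hz, hdet z hz, abs_of_nonneg (hnn z hz)]

section BlowUp

section Mu

variable {μ : ℚ} (hμ : 0 < μ ∧ μ ≤ 2)

/-- **The fibre substitution** `s = 3/(3 − μk²q(u))`, turning `[□², k/(3 − μk²q(u))]` into the band
`[0 ≤ u ≤ 1, 1 ≤ s ≤ 3/(3 − μq(u)), c'/(q(u)s)]` whenever `2μc' = 1`. -/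
theorem fibre_step (c' : ℚ) (hc : 2 * μ * c' = 1) (V : LogArg 0 1)
    (hV : ∀ t ∈ Icc (0 : ℝ) 1, V.v t = 3 / (3 - μ * qf t)) :
    KZ.of ((Tblow hμ).rename (Equiv.swap 0 1)).rep - KZ.of (U 0 1 c' V) ∈ KZ.relations := by
  have hμ0 : (0 : ℝ) < μ := by exact_mod_cast hμ.1
  have hcR : (2 : ℝ) * μ * c' = 1 := by exact_mod_cast hc
  have hc' : (c' : ℝ) = 1 / (2 * μ) := by
    rw [eq_div_iff (by positivity)]
    linear_combination hcR
  have hden := fun z (hz : z ∈ cube 2) => den_swap_pos hμ hz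
  refine of_sub_of_mem_relations_of_fibreMap' (G := ivl 0 1) (a := fun _ => 0) (b := fun _ => 1)
    (a' := fun _ => 1) (b' := fun y => V.v (y 0))
    (fun z => 3 / (3 - (μ : ℝ) * qf (z 0) * z 1 ^ 2))
    (fun z => 6 * ((μ : ℝ) * qf (z 0)) * z 1 / (3 - (μ : ℝ) * qf (z 0) * z 1 ^ 2) ^ 2)
    _ (U 0 1 c' V) ?_ rfl (fun _ _ => zero_le_one) ?_ ?_ ?_ ?_ ?_ ?_ ?_ ?_
  · -- the cube is the band over `[0,1]` with edges `0, 1`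
    ext z
    rw [RFun.rep_domain, KZlog.mem_band, last_one_eq, mem_ivl, mem_cube, Fin.forall_fin_two]
    simp only [init2_zero, Rat.cast_zero, Rat.cast_one]
  · -- semialgebraic
    refine (isSemialgebraicFunOn_aeval_div_aeval isSemialgebraic_cube (C 3 : MvPolynomial (Fin 2) ℚ)
      (3 - C μ * ((1 - X 0 + X 0 ^ 2) * X 1 ^ 2)) fun z hz => ?_).congr fun z _ => ?_
    · have h := hden z hz
      simp only [map_sub, map_mul, map_add, map_pow, map_ofNat, map_one, aeval_C, aeval_X, eq_ratCast, qf]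
        at h ⊢
      linarith
    · simp only [map_sub, map_mul, map_add, map_pow, map_ofNat, map_one, aeval_C, aeval_X, eq_ratCast, qf]
      ring
  · -- differentiable
    intro z hz
    have hne := (hden z hz).ne'
    simp only [qf] at hne ⊢
    fun_prop (disch := exact hne)
  · -- derivative along the fibre
    intro z hz
    have hne := (hden z hz).ne'
    show HasDerivAt (fun t => 3 / (3 - (μ : ℝ) * qf ((Fin.snoc (Fin.init z) t : Fin 2 → ℝ) 0) *
      ((Fin.snoc (Fin.init z) t : Fin 2 → ℝ) 1) ^ 2)) _ (z 1)
    simp only [snoc2_zero, snoc2_one, init2_zero]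
    exact hasDerivAt_psi _ _ hne
  · -- positive on the open fibres
    intro z hz h0 _
    have h0' : (0 : ℝ) < z 1 := h0
    have hq := qf_pos (z 0)
    exact div_pos (by positivity) (pow_pos (hden z hz) 2)
  · -- nonnegative on the band
    intro z hz
    have h1 : (0 : ℝ) ≤ z 1 := ((show z ∈ cube 2 from hz) 1).1
    have hq := qf_pos (z 0)
    exact div_nonneg (by positivity) (pow_nonneg (hden z hz).le 2)
  · -- lower edge `s = 0 ↦ 1`
    intro y _
    show 3 / (3 - (μ : ℝ) * qf ((Fin.snoc y 0 : Fin 2 → ℝ) 0) * ((Fin.snoc y 0 : Fin 2 → ℝ) 1) ^ 2) = 1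
    simp
  · -- upper edge `s = 1 ↦ 3/(3 − μq(u))`
    intro y hy
    have hy' : y 0 ∈ Icc (0 : ℝ) 1 := by simpa [mem_ivl] using hy
    show 3 / (3 - (μ : ℝ) * qf ((Fin.snoc y 1 : Fin 2 → ℝ) 0) * ((Fin.snoc y 1 : Fin 2 → ℝ) 1) ^ 2) = V.v (y 0)
    rw [hV _ hy']
    simp
  · -- integrands
    intro z hz
    have hzc : z ∈ cube 2 := hz
    have hD := (hden z hzc).ne'
    have hq := (qf_pos (z 0)).ne'
    rw [RFun.rep_integrand, RFun.fn_rename, U_integrand]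
    simp only [RFun.fn, Tblow, Qblow, map_sub, map_mul, map_add, map_pow, map_ofNat, map_one, aeval_C,
      aeval_X, eq_ratCast, Function.comp_apply, Equiv.swap_apply_left, Equiv.swap_apply_right, snoc2_zero,
      snoc2_one, init2_zero]
    rw [hc']
    simp only [qf] at hD hq ⊢
    have hD' : (3 : ℝ) - μ * (z 1 ^ 2 * (1 - z 0 + z 0 ^ 2)) ≠ 0 := by
      rw [show (3 : ℝ) - μ * (z 1 ^ 2 * (1 - z 0 + z 0 ^ 2)) = 3 - μ * (1 - z 0 + z 0 ^ 2) * z 1 ^ 2 by ring]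
      exact hD
    field_simp
    ring

/-- **Part I**: `[□², 1/(3 − μN(1−x,1−y))] ≡ 2·[0 ≤ u ≤ 1, 1 ≤ s ≤ 3/(3−μq(u)), c'/(q(u)s)]`, `2μc' = 1`. -/
theorem chain (c' : ℚ) (hc : 2 * μ * c' = 1) (V : LogArg 0 1)
    (hV : ∀ t ∈ Icc (0 : ℝ) 1, V.v t = 3 / (3 - μ * qf t)) :
    KZ.of (Torig hμ).rep - 2 • KZ.of (U 0 1 c' V) ∈ KZ.relations := by
  have E0 := Torig_Tmid hμ
  have E1 := Tmid_Tfin hμ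
  have E2 := rel_fold_diag (Tfin hμ) (Tfin_swap hμ)
  have E3 := rLow_rLowo hμ
  have E4 := rSo_rLowo hμ
  have E5 := Tblow_rSo hμ
  have E6 := Tblow_swap hμ
  have E7 := fibre_step hμ c' hc V hV
  have h := add_mem (add_mem (add_mem E0 E1) E2)
    (zsmul_mem (add_mem (add_mem (sub_mem (sub_mem E3 E4) E5) E6) E7) 2)
  convert h using 1
  abel

end Mu

end BlowUp

section Census

/-! ## Linear bookkeeping on cube representations (reproduced from g6) -/

/-- `[T + S] ≡ [T] + [S]` on the square (rule 1b). -/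
private theorem rel_lin (TS T S : RFun 2) (h : ∀ x ∈ cube 2, TS.fn x = T.fn x + S.fn x) :
    KZ.of TS.rep - KZ.of T.rep - KZ.of S.rep ∈ KZ.relations :=
  KZ.cubicalLinGens_subset_relations (KZ.mem_cubicalLinGens TS.isTameCube_rep T.isTameCube_rep
    S.isTameCube_rep fun x hx => by simpa using h x hx)

/-- `[2T] ≡ 2·[T]` on the square. -/
private theorem rel_double (T T2 : RFun 2) (h : ∀ x ∈ cube 2, T2.fn x = T.fn x + T.fn x) :
    KZ.of T2.rep - 2 • KZ.of T.rep ∈ KZ.relations := by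
  have h1 := rel_lin T2 T T h
  have : KZ.of T2.rep - 2 • KZ.of T.rep = KZ.of T2.rep - KZ.of T.rep - KZ.of T.rep := by abel
  rwa [this]

/-! ## Census pair #22: `4·[□², 1/(1+2x+2y−2x²+2xy−2y²)] − 5·[□², 1/(2+x+y−x²+xy−y²)]` -/

/-- `Q_A = 1 + 2x + 2y − 2x² + 2xy − 2y²` (census K-M2-DARK pair #22, first member). -/
def QA22 : MvPolynomial (Fin 2) ℚ := 1 + 2 * X 0 + 2 * X 1 - 2 * X 0 ^ 2 + 2 * X 0 * X 1 - 2 * X 1 ^ 2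
/-- `Q_B = 2 + x + y − x² + xy − y²` (census K-M2-DARK pair #22, second member). -/
def QB22 : MvPolynomial (Fin 2) ℚ := 2 + X 0 + X 1 - X 0 ^ 2 + X 0 * X 1 - X 1 ^ 2

/-- `hμA`: auxiliary theorem of the lens-6 development «eis» (instances of 28994/4280) — see the module docstring; verbatim from the lens file. -/
theorem hμA : (0 : ℚ) < 2 ∧ (2 : ℚ) ≤ 2 := ⟨by norm_num, le_rfl⟩
/-- `hμB`: auxiliary theorem of the lens-6 development «eis» (instances of 28994/4280) — see the module docstring; verbatim from the lens file. -/
theorem hμB : (0 : ℚ) < 1 ∧ (1 : ℚ) ≤ 2 := ⟨by norm_num, by norm_num⟩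

/-- `Q_A = 3 − 2·N(1−x, 1−y)`. -/
theorem QA22_eq (x : Fin 2 → ℝ) : aeval x QA22 = aeval x (Qorig 2) := by
  simp only [QA22, Qorig, map_sub, map_mul, map_add, map_pow, map_ofNat, map_one, aeval_X]
  ring

/-- `Q_B = 3 − N(1−x, 1−y)`. -/
theorem QB22_eq (x : Fin 2 → ℝ) : aeval x QB22 = aeval x (Qorig 1) := by
  simp only [QB22, Qorig, map_sub, map_mul, map_add, map_pow, map_ofNat, map_one, aeval_X]
  ring

/-- `QA22_pos`: auxiliary theorem of the lens-6 development «eis» (instances of 28994/4280) — see the module docstring; verbatim from the lens file. -/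
theorem QA22_pos {x : Fin 2 → ℝ} (hx : x ∈ cube 2) : 0 < aeval x QA22 := by
  rw [QA22_eq]; exact Qorig_pos hμA hx

/-- `QB22_pos`: auxiliary theorem of the lens-6 development «eis» (instances of 28994/4280) — see the module docstring; verbatim from the lens file. -/
theorem QB22_pos {x : Fin 2 → ℝ} (hx : x ∈ cube 2) : 0 < aeval x QB22 := by
  rw [QB22_eq]; exact Qorig_pos hμB hx

end Census

end Summit.KontsevichZagierPeriods.RootDecompQuadraticDescent.EisensteinPair

end
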